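import Summits.CriticalPhenomena.PercolationContinuityZ3.Theorems.PercNearOneGluingNoHeavyLowerTailSahiGridPatternDiagCertLiteralAnd
import Summits.CriticalPhenomena.PercolationContinuityZ3.Theorems.PercNearOneGluingNoHeavyLowerTailSahiGridPatternDiagCertLiteralOr
import Summits.CriticalPhenomena.PercolationContinuityZ3.Theorems.PercNearOneGluingNoHeavyLowerTailSahiGridPatternCylinderOneAxis

/-!
# `NoHeavyLowerTail` (crux stmt-CriticalPhenomena-4575), Sahi programme P1: **DIAGONAL CERTIFICATES PROPAGATE THROUGH THE THRESHOLD-2 LITERAL-AND STEP** —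
# if `d` certifies `V ⊆ [3]^k` then `d' = (0, 0, 2d)` certifies `{x₀ = 2} ∧ V ⊆ [3]^{1+k}` (every `k`), hence the glued set is good in EVERY dimension

Support file (Sahi cell, seat `prim-sahi-p1`, generation 33; `--supports stmt-CriticalPhenomena-4575`).  Pure proofs, no definitions, no `sorry`,
standard axioms.  Vocabulary of `…SahiGridPattern{,CellForm,SliceForm,RectCert,DiagCert}` (`Pd`, `sStarD`, `glue`, `sect`, `cellOf`, `freeOf`, `ind`,
`TotDist`, `thirdPt`, `lamU`, `thetaVal`, `nuCount`, `cylSet`); tools of `…DiagCertLiteralAnd` / `…DiagCertLiteralOr` / `…CylinderOneAxis` (generation 28).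

THE MATHEMATICS.  A DIAGONAL CERTIFICATE of an up-set `U ⊆ [3]^k` (`…SahiGridPatternDiagCert`) is `d : [3]^k → ℤ`, `d ≥ 0`, with
(T) `Σ_{q∈W} d(q) ≤ Σ_{q∈W} λ_U(q)` for every up-set `W` and (N) `Σ_{q∈P, r∈Q} Θ_U(q,r) ≤ Σ_{q∈P∩Q} d(q)` for all up-sets `P, Q`; it proves
`U × [3]^n` good in every dimension (`sStarD_cylSet_nonneg_of_diagCert`).  Generation 28 proved that the literal steps `{x₀ ≥ 1} ∧ V` (map `(0,2d,2d)`,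
`…DiagCertLiteralAnd`) and `{x₀ ≥ 1} ∨ V` (explicit certificate, `…DiagCertLiteralOr`) preserve diagonal certifiability; this file does the THRESHOLD-2 conjunction.
**THEOREM (`diagCert_literalTwoAnd_T`, `diagCert_literalTwoAnd_N`, every `k`).**  Let `V ⊆ [3]^k` be an up-set with diagonal certificate `d`, and
`A = {x ∈ [3]^{1+k} : x₀ = 2 ∧ tail x ∈ V}` (`glue ξ z ∈ A ↔ 2 ≤ ξ 0 ∧ z ∈ V`).  Then
   `d'(x) = 2·d(tail x)` if `x₀ = 2`,   `d'(x) = 0` otherwise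
is a diagonal certificate of `A` in dimension `1+k`: (T') and (N') hold (and `d' ≥ 0`), so (`sStarD_cylSet_literalTwoAnd_nonneg_of_diagCert`) `A × [3]^n` is a
good first slot for every `n`.  PROOF = two identities (found by the generation-28 symbolic LP `nest2.py`, certificate `cert2_T2.json`, re-verified exactly by this
seat on random instances and as a polynomial identity after Latin-role symmetrisation, then proved here):
  (T')  `λ_A(W') − d'(W') = 2[λ_V(W₂) − d(W₂)] + ν_V(W₂ ∖ W₀) + ν_V(W₂ ∖ W₁)`   (`W_t` = sections of the up-set `W'`),
  (N')  `d'(B∩C) − Θ_A(B×C) = 2[d(B₂∩C₂) − Θ_V(B₂×C₂)]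
          + Σ_q (1_{B₂}−1_{B₀})(q)·K_V(q;C₂) + Σ_q (1_{B₂}−1_{B₁})(q)·K_V(q;C₀) + Σ_r (1_{C₂}−1_{C₀})(r)·K_V(r;B₂) + Σ_r (1_{C₂}−1_{C₁})(r)·K_V(r;B₀)
          + Σ_{q δ̸ r} 1_V(q)(1_{B₂}−1_{B₀})(q)(1_{C₂}−1_{C₁})(r) + Σ_{q δ̸ r} 1_V(q)(1_{C₂}−1_{C₀})(q)(1_{B₂}−1_{B₁})(r)`,
  where `K_V(q;X) = Σ_{r δ̸ q} 1_X(r)(1_V(r) − 1_V(q̄r)) ≥ 0` is Kleitman's inequality in the cube around `q`; every bracket is `≥ 0` by (N), (T), nested sections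
  or Kleitman.  (The (N') identity is proved at the level of pair sums, symmetrised over the six Latin roles — for which this file adds the role-symmetrisation
  lemma `sum_sum_eq_of_latin6_eq` for ARBITRARY kernels, a hypothesis-free form of `pairSum_eq_of_sym6_eq`.)
With `…DiagCertLiteralAnd/Or` and the companion threshold-2 disjunction file, the class of DIAGONALLY CERTIFIED up-sets is closed under ALL FOUR one-axis literal
steps (and the cylinder, `…DiagCertLift`, and block-AND with a top-cube first block, `…DiagRouteTopCubeCert`).  Nothing here asserts `PatternPos d` for `d ≥ 4`. [this work]
-/

namespace Summit.CriticalPhenomena.PercolationContinuityZ3.Theorems.SahiGridPattern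

open Finset SahiGrid3
open scoped BigOperators

variable {k : ℕ}

/-! ### Latin-role symmetrisation for arbitrary kernels -/

/-- Re-indexing the second point by the third point of the Latin line (an involution for fixed `q`), arbitrary kernel. [this work] -/
theorem sum_sum_latin_rot (f : Pd k → Pd k → ℤ) :
    (∑ q : Pd k, ∑ r : Pd k, f q r) = ∑ q : Pd k, ∑ r : Pd k, f q (thirdPt q r) := by
  refine Finset.sum_congr rfl fun q _ => ?_
  have hinv : Function.Involutive (thirdPt q) := fun r => thirdPt_thirdPt q r
  refine (Fintype.sum_equiv (hinv.toPerm _) (fun r => f q (thirdPt q r)) (fun r => f q r) (fun r => ?_)).symm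
  show f q (thirdPt q r) = f q (thirdPt q r)
  rfl

/-- **Latin-role symmetrisation, arbitrary kernels**: if `f` and `g` have the same sum over the six role assignments `(q,r), (r,q), (q,q̄r), (q̄r,q),
(r,q̄r), (q̄r,r)` at every pair, then `Σ_q Σ_r f = Σ_q Σ_r g` (each role map is a bijection of `[3]^k × [3]^k`). [this work] -/
theorem sum_sum_eq_of_latin6_eq (f g : Pd k → Pd k → ℤ)
    (h : ∀ q r : Pd k, f q r + f r q + f q (thirdPt q r) + f (thirdPt q r) q + f r (thirdPt q r) + f (thirdPt q r) r
        = g q r + g r q + g q (thirdPt q r) + g (thirdPt q r) q + g r (thirdPt q r) + g (thirdPt q r) r) :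
    (∑ q : Pd k, ∑ r : Pd k, f q r) = ∑ q : Pd k, ∑ r : Pd k, g q r := by
  have six : ∀ K : Pd k → Pd k → ℤ,
      (∑ q : Pd k, ∑ r : Pd k, (K q r + K r q + K q (thirdPt q r) + K (thirdPt q r) q + K r (thirdPt q r) + K (thirdPt q r) r))
      = 6 * ∑ q : Pd k, ∑ r : Pd k, K q r := by
    intro K
    have e1 : (∑ q : Pd k, ∑ r : Pd k, K r q) = ∑ q : Pd k, ∑ r : Pd k, K q r := Finset.sum_comm
    have e2 : (∑ q : Pd k, ∑ r : Pd k, K q (thirdPt q r)) = ∑ q : Pd k, ∑ r : Pd k, K q r := (sum_sum_latin_rot K).symm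
    have e3 : (∑ q : Pd k, ∑ r : Pd k, K (thirdPt q r) q) = ∑ q : Pd k, ∑ r : Pd k, K q r := by
      rw [← sum_sum_latin_rot (fun q r => K r q)]; exact e1
    have e4 : (∑ q : Pd k, ∑ r : Pd k, K r (thirdPt q r)) = ∑ q : Pd k, ∑ r : Pd k, K q r := by
      rw [Finset.sum_comm, ← e2]
      refine Finset.sum_congr rfl fun q _ => Finset.sum_congr rfl fun r _ => ?_
      rw [thirdPt_comm r q]
    have e5 : (∑ q : Pd k, ∑ r : Pd k, K (thirdPt q r) r) = ∑ q : Pd k, ∑ r : Pd k, K q r := by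
      rw [Finset.sum_comm, ← e3]
      refine Finset.sum_congr rfl fun q _ => Finset.sum_congr rfl fun r _ => ?_
      rw [thirdPt_comm r q]
    simp only [Finset.sum_add_distrib]
    rw [e1, e2, e3, e4, e5]
    ring
  have hF := six f
  have hG := six g
  have hFG : (∑ q : Pd k, ∑ r : Pd k, (f q r + f r q + f q (thirdPt q r) + f (thirdPt q r) q + f r (thirdPt q r) + f (thirdPt q r) r))
      = ∑ q : Pd k, ∑ r : Pd k, (g q r + g r q + g q (thirdPt q r) + g (thirdPt q r) q + g r (thirdPt q r) + g (thirdPt q r) r) :=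
    Finset.sum_congr rfl fun q _ => Finset.sum_congr rfl fun r _ => h q r
  rw [hF, hG] at hFG
  omega

/-- The six `TotDist` role values and the four nested third points, normalised to `TotDist q r` / `q`, `r`. [this work] -/
theorem latin6_norm (q r : Pd k) :
    TotDist r q = TotDist q r ∧ TotDist q (thirdPt q r) = TotDist q r ∧ TotDist (thirdPt q r) q = TotDist q r
    ∧ TotDist r (thirdPt q r) = TotDist q r ∧ TotDist (thirdPt q r) r = TotDist q r
    ∧ thirdPt q (thirdPt q r) = r ∧ thirdPt (thirdPt q r) q = r ∧ thirdPt r (thirdPt q r) = q ∧ thirdPt (thirdPt q r) r = q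
    ∧ thirdPt r q = thirdPt q r := by
  obtain ⟨c1, c2, c3, c4⟩ := thirdPt_cancel q r
  refine ⟨totDist_symm r q, totDist_thirdPt_right q r, ?_, ?_, ?_, c1, c2, c3, c4, thirdPt_comm r q⟩
  · rw [totDist_symm (thirdPt q r) q, totDist_thirdPt_right]
  · rw [thirdPt_comm q r, totDist_thirdPt_right r q, totDist_symm r q]
  · rw [totDist_symm (thirdPt q r) r, thirdPt_comm q r, totDist_thirdPt_right r q, totDist_symm r q]

/-- Section increments of an up-set of `[3]^{1+k}` along the free axis are nonnegative. -/
private theorem ind_glue_sub_nonneg₂ {B : Finset (Pd (1 + k))} (hB : IsUpperSet (B : Set (Pd (1 + k)))) {s t : Fin 3} (hst : s ≤ t)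
    (q : Pd k) : 0 ≤ ind B (glue (fun _ : Fin 1 => t) q) - ind B (glue (fun _ : Fin 1 => s) q) := by
  unfold ind
  by_cases h : glue (fun _ : Fin 1 => s) q ∈ B
  · rw [if_pos h, if_pos (mem_of_glue_mem_of_le hB hst h)]; norm_num
  · rw [if_neg h]; split_ifs <;> norm_num

variable {V : Finset (Pd k)} {A : Finset (Pd (1 + k))}

/-! ### The glued set `{x₀ = 2} ∧ V`: indicator, `ν` and `λ` by levels -/

/-- Indicator of the threshold-2 literal-AND glued set: `1_A(glue ξ z) = [2 ≤ ξ 0]·1_V(z)`. [this work] -/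
theorem ind_glue_literalTwoAnd (hA : ∀ ξ z, glue ξ z ∈ A ↔ (2 ≤ ξ 0 ∧ z ∈ V)) (ξ : Pd 1) (z : Pd k) :
    ind A (glue ξ z) = (if 2 ≤ ξ 0 then 1 else 0) * ind V z := by
  unfold ind
  simp only [hA]
  by_cases h1 : 2 ≤ ξ 0 <;> by_cases h2 : z ∈ V <;> simp [h1, h2]

/-- Levels `0` and `1` of `A` are empty, level `2` is `V`. [this work] -/
theorem ind_glue_literalTwoAnd_levels (hA : ∀ ξ z, glue ξ z ∈ A ↔ (2 ≤ ξ 0 ∧ z ∈ V)) (z : Pd k) :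
    ind A (glue (fun _ => 0) z) = 0 ∧ ind A (glue (fun _ => 1) z) = 0 ∧ ind A (glue (fun _ => 2) z) = ind V z := by
  refine ⟨?_, ?_, ?_⟩
  · rw [ind_glue_literalTwoAnd hA]; simp [show ¬ ((2:Fin 3) ≤ 0) by decide]
  · rw [ind_glue_literalTwoAnd hA]; simp [show ¬ ((2:Fin 3) ≤ 1) by decide]
  · rw [ind_glue_literalTwoAnd hA]; simp

/-- `ν_A` at the three levels: `ν_A(0,q) = ν_A(1,q) = ν_V(q)`, `ν_A(2,q) = 0` (as pair sums). [this work] -/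
theorem nuCount_literalTwoAnd_vals (hA : ∀ ξ z, glue ξ z ∈ A ↔ (2 ≤ ξ 0 ∧ z ∈ V)) (q : Pd k) :
    (nuCount A (glue (fun _ => 0) q) : ℤ) = ∑ r : Pd k, ind V r * (if TotDist r q = true then (1:ℤ) else 0)
    ∧ (nuCount A (glue (fun _ => 1) q) : ℤ) = ∑ r : Pd k, ind V r * (if TotDist r q = true then (1:ℤ) else 0)
    ∧ (nuCount A (glue (fun _ => 2) q) : ℤ) = 0 := by
  obtain ⟨h00, h11, h22, h01, h02, h10, h12, h20, h21, -, -, -, -, -, -⟩ := pd1_facts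
  obtain ⟨i0, i1, i2⟩ := And.intro (fun z => (ind_glue_literalTwoAnd_levels hA z).1)
    (And.intro (fun z => (ind_glue_literalTwoAnd_levels hA z).2.1) (fun z => (ind_glue_literalTwoAnd_levels hA z).2.2))
  have e : ∀ ξ : Pd 1, (nuCount A (glue ξ q) : ℤ) =
      (if TotDist (fun _ : Fin 1 => (2:Fin 3)) ξ = true then (1:ℤ) else 0)
        * ∑ r : Pd k, ind V r * (if TotDist r q = true then (1:ℤ) else 0) := by
    intro ξ
    rw [nuCount_glue_eq, sum_pd1]
    simp only [i0, i1, i2, zero_mul, Finset.sum_const_zero, mul_zero, zero_add]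
  refine ⟨?_, ?_, ?_⟩
  · rw [e]; simp only [h20]; norm_num
  · rw [e]; simp only [h21]; norm_num
  · rw [e]; simp only [h22]; norm_num

/-- `λ_A` at the three levels: `λ_A(0,q) = λ_A(1,q) = −ν_V(q)`, `λ_A(2,q) = 2^{k+2}·1_V(q)`. [this work] -/
theorem lamU_literalTwoAnd_levels (hA : ∀ ξ z, glue ξ z ∈ A ↔ (2 ≤ ξ 0 ∧ z ∈ V)) (q : Pd k) :
    lamU A (glue (fun _ => 0) q) = - ∑ r : Pd k, ind V r * (if TotDist r q = true then (1:ℤ) else 0)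
    ∧ lamU A (glue (fun _ => 1) q) = - ∑ r : Pd k, ind V r * (if TotDist r q = true then (1:ℤ) else 0)
    ∧ lamU A (glue (fun _ => 2) q) = 2 * 2 ^ (1 + k) * ind V q := by
  obtain ⟨n0, n1, n2⟩ := nuCount_literalTwoAnd_vals hA q
  obtain ⟨i0, i1, i2⟩ := ind_glue_literalTwoAnd_levels hA q
  unfold lamU
  rw [n0, n1, n2, i0, i1, i2]
  refine ⟨by ring, by ring, by ring⟩

/-! ### (T') -/

/-- **(T') for the threshold-2 literal-AND step**: if `d` satisfies (T) for `V`, then `d' = (0, 0, 2d)` satisfies (T) for `A = {x₀ = 2} ∧ V`: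
`Σ_{x∈W'} d'(x) ≤ Σ_{x∈W'} λ_A(x)` for every up-set `W' ⊆ [3]^{1+k}`. [this work] -/
theorem diagCert_literalTwoAnd_T (hA : ∀ ξ z, glue ξ z ∈ A ↔ (2 ≤ ξ 0 ∧ z ∈ V)) (d : Pd k → ℤ)
    (hT : ∀ W : Finset (Pd k), IsUpperSet (W : Set (Pd k)) → (∑ q ∈ W, d q) ≤ ∑ q ∈ W, lamU V q)
    (W' : Finset (Pd (1 + k))) (hW' : IsUpperSet (W' : Set (Pd (1 + k)))) :
    (∑ x ∈ W', (fun x => if freeOf x 0 = 2 then 2 * d (cellOf x) else (0:ℤ)) x) ≤ ∑ x ∈ W', lamU A x := by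
  have hl := lamU_literalTwoAnd_levels hA
  rw [sum_mem_eq_levels W' _, sum_mem_eq_levels W' (lamU A)]
  simp only [freeOf_glue, cellOf_glue, show ¬ ((0:Fin 3) = 2) by decide, show ¬ ((1:Fin 3) = 2) by decide, if_false, if_true, mul_zero,
    Finset.sum_const_zero, zero_add]
  -- (T) for V at the section W₂
  have hT2 := hT (sect W' (fun _ => 2)) (isUpperSet_sect hW' _)
  rw [sum_mem_eq_sum_ind_mul, sum_mem_eq_sum_ind_mul (sect W' _) (lamU V)] at hT2
  simp only [ind_sect] at hT2
  have hlamV : ∀ q : Pd k, lamU V q = 2 * 2 ^ k * ind V q - ∑ r : Pd k, ind V r * (if TotDist r q = true then (1:ℤ) else 0) := by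
    intro q; unfold lamU; rw [nuCount_eq_sum_ind]
  have hn02 : ∀ q : Pd k, ind W' (glue (fun _ => 0) q) ≤ ind W' (glue (fun _ => 2) q) := fun q => by
    have := ind_glue_sub_nonneg₂ hW' (show (0:Fin 3) ≤ 2 by decide) q; linarith
  have hn12 : ∀ q : Pd k, ind W' (glue (fun _ => 1) q) ≤ ind W' (glue (fun _ => 2) q) := fun q => by
    have := ind_glue_sub_nonneg₂ hW' (show (1:Fin 3) ≤ 2 by decide) q; linarith
  have hνnn : ∀ q : Pd k, 0 ≤ ∑ r : Pd k, ind V r * (if TotDist r q = true then (1:ℤ) else 0) :=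
    fun q => Finset.sum_nonneg fun r _ => mul_nonneg (ind_nonneg' V r) (by split_ifs <;> norm_num)
  have e0 : (∑ q : Pd k, ind W' (glue (fun _ => 0) q) * lamU A (glue (fun _ => 0) q))
      = ∑ q : Pd k, ind W' (glue (fun _ => 0) q) * (- ∑ r : Pd k, ind V r * (if TotDist r q = true then (1:ℤ) else 0)) :=
    Finset.sum_congr rfl fun q _ => by rw [(hl q).1]
  have e1 : (∑ q : Pd k, ind W' (glue (fun _ => 1) q) * lamU A (glue (fun _ => 1) q))
      = ∑ q : Pd k, ind W' (glue (fun _ => 1) q) * (- ∑ r : Pd k, ind V r * (if TotDist r q = true then (1:ℤ) else 0)) :=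
    Finset.sum_congr rfl fun q _ => by rw [(hl q).2.1]
  have e2 : (∑ q : Pd k, ind W' (glue (fun _ => 2) q) * lamU A (glue (fun _ => 2) q))
      = 2 * (∑ q : Pd k, ind W' (glue (fun _ => 2) q) * lamU V q)
        + 2 * (∑ q : Pd k, ind W' (glue (fun _ => 2) q) * ∑ r : Pd k, ind V r * (if TotDist r q = true then (1:ℤ) else 0)) := by
    rw [Finset.mul_sum, Finset.mul_sum, ← Finset.sum_add_distrib]
    refine Finset.sum_congr rfl fun q _ => ?_
    rw [(hl q).2.2, hlamV q, pow_add, pow_one]; ring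
  have s2 : (∑ q : Pd k, ind W' (glue (fun _ => 2) q) * (2 * d q)) = 2 * ∑ q : Pd k, ind W' (glue (fun _ => 2) q) * d q := by
    rw [Finset.mul_sum]; refine Finset.sum_congr rfl fun q _ => ?_; ring
  rw [e0, e1, e2, s2]
  -- the slack: (2·1_{W₂} − 1_{W₀} − 1_{W₁})·ν_V ≥ 0 pointwise
  have k0 : 0 ≤ (∑ q : Pd k, ind W' (glue (fun _ => 0) q) * (- ∑ r : Pd k, ind V r * (if TotDist r q = true then (1:ℤ) else 0)))
      + (∑ q : Pd k, ind W' (glue (fun _ => 1) q) * (- ∑ r : Pd k, ind V r * (if TotDist r q = true then (1:ℤ) else 0)))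
      + 2 * (∑ q : Pd k, ind W' (glue (fun _ => 2) q) * ∑ r : Pd k, ind V r * (if TotDist r q = true then (1:ℤ) else 0)) := by
    rw [Finset.mul_sum, ← Finset.sum_add_distrib, ← Finset.sum_add_distrib]
    refine Finset.sum_nonneg fun q _ => ?_
    have := hn02 q; have := hn12 q; have := hνnn q
    nlinarith
  linarith

/-! ### (N') -/

/-- **(N') for the threshold-2 literal-AND step**: if `d` (no sign needed) satisfies (N) for the up-set `V`, then `d' = (0, 0, 2d)` satisfies (N) for
`A = {x₀ = 2} ∧ V`: `Σ_{x∈B, y∈C} Θ_A(x,y) ≤ Σ_{x∈B∩C} d'(x)` for all up-sets `B, C ⊆ [3]^{1+k}`. [this work] -/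
theorem diagCert_literalTwoAnd_N (hV : IsUpperSet (V : Set (Pd k))) (hA : ∀ ξ z, glue ξ z ∈ A ↔ (2 ≤ ξ 0 ∧ z ∈ V)) (d : Pd k → ℤ)
    (hN : ∀ P Q : Finset (Pd k), IsUpperSet (P : Set (Pd k)) → IsUpperSet (Q : Set (Pd k)) →
      (∑ q ∈ P, ∑ r ∈ Q, thetaVal V q r) ≤ ∑ q ∈ P ∩ Q, d q)
    (B C : Finset (Pd (1 + k))) (hB : IsUpperSet (B : Set (Pd (1 + k)))) (hC : IsUpperSet (C : Set (Pd (1 + k)))) :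
    (∑ x ∈ B, ∑ y ∈ C, thetaVal A x y) ≤ ∑ x ∈ B ∩ C, (fun x => if freeOf x 0 = 2 then 2 * d (cellOf x) else (0:ℤ)) x := by
  obtain ⟨i0, i1, i2⟩ := And.intro (fun z => (ind_glue_literalTwoAnd_levels hA z).1)
    (And.intro (fun z => (ind_glue_literalTwoAnd_levels hA z).2.1) (fun z => (ind_glue_literalTwoAnd_levels hA z).2.2))
  have hl := lamU_literalTwoAnd_levels hA
  -- Θ_A-sum = λ_A(B∩C) − sStarD A B C
  have eS := sStarD_eq_sum_lamU_sub_sum_thetaVal A B C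
  suffices key : (∑ x ∈ B ∩ C, lamU A x) - (∑ x ∈ B ∩ C, (fun x => if freeOf x 0 = 2 then 2 * d (cellOf x) else (0:ℤ)) x) ≤ sStarD A B C by
    linarith
  -- λ_A(B∩C) as a pair sum
  have L1 : (∑ x ∈ B ∩ C, lamU A x)
      = ∑ q : Pd k, ∑ r : Pd k, (if TotDist q r = true then (1:ℤ) else 0) *
          ( - (ind B (glue (fun _ => 0) q) * ind C (glue (fun _ => 0) q) * ind V r)
            - ind B (glue (fun _ => 1) q) * ind C (glue (fun _ => 1) q) * ind V r
            + 4 * (ind B (glue (fun _ => 2) q) * ind C (glue (fun _ => 2) q) * ind V q) ) := by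
    rw [sum_mem_eq_levels]
    simp only [ind_inter_eq_mul]
    have c4 : ∀ q : Pd k, (2:ℤ) * 2 ^ (1 + k) * ind V q = ∑ r : Pd k, (if TotDist q r = true then (1:ℤ) else 0) * (4 * ind V q) := by
      intro q; rw [← Finset.sum_mul, sum_ite_totDist_eq_two_pow, pow_add, pow_one]; ring
    have cν : ∀ q : Pd k, (∑ r : Pd k, ind V r * (if TotDist r q = true then (1:ℤ) else 0))
        = ∑ r : Pd k, (if TotDist q r = true then (1:ℤ) else 0) * ind V r := by
      intro q; refine Finset.sum_congr rfl fun r _ => ?_; rw [totDist_symm r q]; ring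
    rw [← Finset.sum_add_distrib, ← Finset.sum_add_distrib]
    refine Finset.sum_congr rfl fun q _ => ?_
    rw [(hl q).1, (hl q).2.1, (hl q).2.2, c4 q, cν q]
    rw [mul_neg, mul_neg, Finset.mul_sum, Finset.mul_sum, Finset.mul_sum, ← Finset.sum_neg_distrib, ← Finset.sum_neg_distrib,
      ← Finset.sum_add_distrib, ← Finset.sum_add_distrib]
    refine Finset.sum_congr rfl fun r _ => ?_
    ring
  -- d'(B∩C) = 2·Σ_q 1_{B₂}(q)1_{C₂}(q) d(q)
  have L2 : (∑ x ∈ B ∩ C, (fun x => if freeOf x 0 = 2 then 2 * d (cellOf x) else (0:ℤ)) x)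
      = 2 * ∑ q : Pd k, ind B (glue (fun _ => 2) q) * ind C (glue (fun _ => 2) q) * d q := by
    rw [sum_mem_eq_levels]
    simp only [ind_inter_eq_mul, freeOf_glue, cellOf_glue, show ¬ ((0:Fin 3) = 2) by decide, show ¬ ((1:Fin 3) = 2) by decide,
      if_false, if_true, mul_zero, Finset.sum_const_zero, zero_add]
    rw [Finset.mul_sum]
    refine Finset.sum_congr rfl fun q _ => ?_; ring
  -- the pattern functional of A, one axis explicit, sections of A substituted
  have L3 := sStarD_eq_pd1_sections A B C
  simp only [i0, i1, i2] at L3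
  -- hypothesis (N) at the section pair (B₂,C₂), in pair-sum form
  have hN22 := hN (sect B (fun _ => 2)) (sect C (fun _ => 2)) (isUpperSet_sect hB _) (isUpperSet_sect hC _)
  rw [sum_sum_thetaVal_eq_pairSum, sum_mem_eq_sum_ind_mul (sect B _ ∩ sect C _)] at hN22
  simp only [ind_inter_eq_mul, ind_sect] at hN22
  -- the four weighted Kleitman sums and the two pointwise products
  have hB02 := fun q => ind_glue_sub_nonneg₂ hB (show (0:Fin 3) ≤ 2 by decide) q
  have hB12 := fun q => ind_glue_sub_nonneg₂ hB (show (1:Fin 3) ≤ 2 by decide) q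
  have hC02 := fun q => ind_glue_sub_nonneg₂ hC (show (0:Fin 3) ≤ 2 by decide) q
  have hC12 := fun q => ind_glue_sub_nonneg₂ hC (show (1:Fin 3) ≤ 2 by decide) q
  have hVn : ∀ q : Pd k, 0 ≤ ind V q := fun q => ind_nonneg' V q
  have K1 := weighted_kleitman_nonneg hV (isUpperSet_sect hC (fun _ => 2)) _ hB02
  have K2 := weighted_kleitman_nonneg hV (isUpperSet_sect hC (fun _ => 0)) _ hB12
  have K3 := weighted_kleitman_nonneg hV (isUpperSet_sect hB (fun _ => 2)) _ hC02
  have K4 := weighted_kleitman_nonneg hV (isUpperSet_sect hB (fun _ => 0)) _ hC12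
  simp only [ind_sect] at K1 K2 K3 K4
  have P1 : 0 ≤ ∑ q : Pd k, ∑ r : Pd k, (if TotDist q r = true then (1:ℤ) else 0) *
      (ind V q * ((ind B (glue (fun _ => 2) q) - ind B (glue (fun _ => 0) q)) * (ind C (glue (fun _ => 2) r) - ind C (glue (fun _ => 1) r)))) :=
    Finset.sum_nonneg fun q _ => Finset.sum_nonneg fun r _ => mul_nonneg (by split_ifs <;> norm_num)
      (mul_nonneg (hVn q) (mul_nonneg (hB02 q) (hC12 r)))
  have P2 : 0 ≤ ∑ q : Pd k, ∑ r : Pd k, (if TotDist q r = true then (1:ℤ) else 0) *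
      (ind V q * ((ind C (glue (fun _ => 2) q) - ind C (glue (fun _ => 0) q)) * (ind B (glue (fun _ => 2) r) - ind B (glue (fun _ => 1) r)))) :=
    Finset.sum_nonneg fun q _ => Finset.sum_nonneg fun r _ => mul_nonneg (by split_ifs <;> norm_num)
      (mul_nonneg (hVn q) (mul_nonneg (hC02 q) (hB12 r)))
  -- the pair-sum identity (valid after symmetrisation over the six Latin roles):
  --   sStarD − λ_A(B∩C) + 2Θ_V(B₂×C₂) = K1 + K2 + K3 + K4 + P1 + P2
  have PairId : sStarD A B C
      - (∑ q : Pd k, ∑ r : Pd k, (if TotDist q r = true then (1:ℤ) else 0) *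
          ( - (ind B (glue (fun _ => 0) q) * ind C (glue (fun _ => 0) q) * ind V r)
            - ind B (glue (fun _ => 1) q) * ind C (glue (fun _ => 1) q) * ind V r
            + 4 * (ind B (glue (fun _ => 2) q) * ind C (glue (fun _ => 2) q) * ind V q) ))
      + 2 * (∑ q : Pd k, ∑ r : Pd k, (if TotDist q r = true then (1:ℤ) else 0) *
          (ind B (glue (fun _ => 2) q) * ind C (glue (fun _ => 2) r) * (ind V q + ind V r - ind V (thirdPt q r))))
      = (∑ q : Pd k, ∑ r : Pd k, (if TotDist q r = true then (1:ℤ) else 0) *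
          ((ind B (glue (fun _ => 2) q) - ind B (glue (fun _ => 0) q)) * (ind C (glue (fun _ => 2) r) * (ind V r - ind V (thirdPt q r)))))
      + (∑ q : Pd k, ∑ r : Pd k, (if TotDist q r = true then (1:ℤ) else 0) *
          ((ind B (glue (fun _ => 2) q) - ind B (glue (fun _ => 1) q)) * (ind C (glue (fun _ => 0) r) * (ind V r - ind V (thirdPt q r)))))
      + (∑ q : Pd k, ∑ r : Pd k, (if TotDist q r = true then (1:ℤ) else 0) *
          ((ind C (glue (fun _ => 2) q) - ind C (glue (fun _ => 0) q)) * (ind B (glue (fun _ => 2) r) * (ind V r - ind V (thirdPt q r)))))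
      + (∑ q : Pd k, ∑ r : Pd k, (if TotDist q r = true then (1:ℤ) else 0) *
          ((ind C (glue (fun _ => 2) q) - ind C (glue (fun _ => 1) q)) * (ind B (glue (fun _ => 0) r) * (ind V r - ind V (thirdPt q r)))))
      + (∑ q : Pd k, ∑ r : Pd k, (if TotDist q r = true then (1:ℤ) else 0) *
          (ind V q * ((ind B (glue (fun _ => 2) q) - ind B (glue (fun _ => 0) q)) * (ind C (glue (fun _ => 2) r) - ind C (glue (fun _ => 1) r)))))
      + (∑ q : Pd k, ∑ r : Pd k, (if TotDist q r = true then (1:ℤ) else 0) *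
          (ind V q * ((ind C (glue (fun _ => 2) q) - ind C (glue (fun _ => 0) q)) * (ind B (glue (fun _ => 2) r) - ind B (glue (fun _ => 1) r))))) := by
    rw [L3]
    simp only [Finset.mul_sum, ← Finset.sum_add_distrib, ← Finset.sum_sub_distrib]
    refine sum_sum_eq_of_latin6_eq _ _ fun q r => ?_
    obtain ⟨t1, t2, t3, t4, t5, c1, c2, c3, c4, c5⟩ := latin6_norm (k := k) q r
    simp only [t1, t2, t3, t4, t5, c1, c2, c3, c4, c5]
    ring
  rw [L1, L2]
  linarith [PairId, K1, K2, K3, K4, P1, P2, hN22]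

/-- **THE THRESHOLD-2 LITERAL-AND STEP PRESERVES DIAGONAL CERTIFIABILITY, hence goodness in EVERY dimension**: if the up-set `V ⊆ [3]^k` has a
diagonal certificate `d` and `A = {x₀ = 2} ∧ V ⊆ [3]^{1+k}`, then `A × [3]^n` is a good first slot for all `n`. [this work] -/
theorem sStarD_cylSet_literalTwoAnd_nonneg_of_diagCert (hV : IsUpperSet (V : Set (Pd k))) (hA : ∀ ξ z, glue ξ z ∈ A ↔ (2 ≤ ξ 0 ∧ z ∈ V))
    (d : Pd k → ℤ) (hd : ∀ q, 0 ≤ d q)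
    (hT : ∀ W : Finset (Pd k), IsUpperSet (W : Set (Pd k)) → (∑ q ∈ W, d q) ≤ ∑ q ∈ W, lamU V q)
    (hN : ∀ P Q : Finset (Pd k), IsUpperSet (P : Set (Pd k)) → IsUpperSet (Q : Set (Pd k)) →
      (∑ q ∈ P, ∑ r ∈ Q, thetaVal V q r) ≤ ∑ q ∈ P ∩ Q, d q)
    {n : ℕ} {B C : Finset (Pd (n + (1 + k)))} (hB : IsUpperSet (B : Set (Pd (n + (1 + k))))) (hC : IsUpperSet (C : Set (Pd (n + (1 + k))))) :
    0 ≤ sStarD (cylSet A : Finset (Pd (n + (1 + k)))) B C :=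
  sStarD_cylSet_nonneg_of_diagCert A (fun x => if freeOf x 0 = 2 then 2 * d (cellOf x) else (0:ℤ))
    (fun x => by
      show 0 ≤ (if freeOf x 0 = 2 then 2 * d (cellOf x) else (0:ℤ))
      split_ifs
      · exact mul_nonneg (by norm_num) (hd _)
      · exact le_rfl)
    (fun W' hW' => diagCert_literalTwoAnd_T hA d hT W' hW')
    (fun P Q hP hQ => diagCert_literalTwoAnd_N hV hA d hN P Q hP hQ) hB hC

/-- **The threshold-2 literal-AND step in the slot's own dimension** (no sign condition on `d`): (T), (N) for `V` give `0 ≤ sStarD A B C` for all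
up-sets `B, C ⊆ [3]^{1+k}`. [this work] -/
theorem sStarD_literalTwoAnd_nonneg_of_diagCert (hV : IsUpperSet (V : Set (Pd k))) (hA : ∀ ξ z, glue ξ z ∈ A ↔ (2 ≤ ξ 0 ∧ z ∈ V))
    (d : Pd k → ℤ)
    (hT : ∀ W : Finset (Pd k), IsUpperSet (W : Set (Pd k)) → (∑ q ∈ W, d q) ≤ ∑ q ∈ W, lamU V q)
    (hN : ∀ P Q : Finset (Pd k), IsUpperSet (P : Set (Pd k)) → IsUpperSet (Q : Set (Pd k)) →
      (∑ q ∈ P, ∑ r ∈ Q, thetaVal V q r) ≤ ∑ q ∈ P ∩ Q, d q)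
    {B C : Finset (Pd (1 + k))} (hB : IsUpperSet (B : Set (Pd (1 + k)))) (hC : IsUpperSet (C : Set (Pd (1 + k)))) :
    0 ≤ sStarD A B C :=
  sStarD_nonneg_of_diagCert A (fun x => if freeOf x 0 = 2 then 2 * d (cellOf x) else (0:ℤ))
    (fun W' hW' => diagCert_literalTwoAnd_T hA d hT W' hW')
    (fun P Q hP hQ => diagCert_literalTwoAnd_N hV hA d hN P Q hP hQ) hB hC

end Summit.CriticalPhenomena.PercolationContinuityZ3.Theorems.SahiGridPattern
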